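import Mathlib

/-!
# PneNP / OverlapGapAlgebra — crux `SolvableImpliesStableSection` (stmt-PneNP-2463):
# the UNIT CLAUSE block (1/·) — the localized unit-clause dynamics exist

Support for crux `stmt-PneNP-2463` (`Summit.PneNP.PneNP.Theses.OverlapGapAlgebra.SolvableImpliesStableSection`),
registered stub `stub_lowDensity` of line `RegimeSplit` (child G: f-free stable sections for
`α < 2^k/k`).  The block proves the conclusion of the crux OUTRIGHT for every `k ≥ 3` and every density
below the Chao–Franco unit-clause threshold `α_UC(k) = (2^{k-1}/k)((k-1)/(k-2))^{k-2} ≥ 2^k/k`, for all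
`η, ν > 0`, by a LOCALIZED UNIT-CLAUSE RULE: `R` synchronous rounds; in round `t` every unset variable
`v` carrying a unit clause (one slot unset and equal to `v`, all other slots set and false) is forced to
satisfy its least-index unit clause, and every other unset variable whose label window `⌊v·R/n⌋` is `t`
is set to `true`.  The rule is radius-`R` local, so the mean-square engine
(`sissMV_concl_of_localMean`) only needs its MEAN violation, which is `O_{k,α}(m/R)` by a
deferred-decision (muting) first/second-moment argument.

As in the earlier blocks the objects are HYPOTHESES; this file constructs them: for every set `S` of
muted clause indices (clauses in `S` never force), the states
`st S t Φ : Fin n → Option Bool` (`none` = unset) and the demanded values `dm S t Φ : Fin n → Bool`.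

* `sissU_exists_dyn` — states and demanded values satisfying the step specification exist.
No definitions of constants; axioms `propext`, `Classical.choice`, `Quot.sound`.
-/

set_option linter.dupNamespace false -- `Summit.PneNP.PneNP.…`: summit = sub-problem (D-0017)

namespace Summit.PneNP.PneNP.Theorems

open Finset
open scoped Classical

section Objects

variable {m k n : ℕ}

/-- **The localized unit-clause dynamics exist.** For a number of rounds/windows `R` there are
`st : Finset (Fin m) → ℕ → instances → Fin n → Option Bool` (state of a variable at the start of round
`t` when the clauses in `S` are muted; `none` = unset) and `dm` (the value demanded by the least unit
clause) such that: all variables are unset at round `0` (`h0`); a set variable keeps its value, an unset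
variable carrying a non-muted unit clause is set to the demanded value, an unset variable without unit
clause is set to `true` in the round of its label window `⌊v·R/n⌋` and stays unset otherwise (`hstep`);
and the demanded value is the sign of `v` in the least non-muted unit clause on `v` (`hdm`). -/
theorem sissU_exists_dyn (R : ℕ) :
    ∃ (st : Finset (Fin m) → ℕ → (Fin m → Fin k → Fin n × Bool) → Fin n → Option Bool)
      (dm : Finset (Fin m) → ℕ → (Fin m → Fin k → Fin n × Bool) → Fin n → Bool),
      (∀ (S : Finset (Fin m)) (Φ : Fin m → Fin k → Fin n × Bool) (v : Fin n), st S 0 Φ v = none) ∧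
      (∀ (S : Finset (Fin m)) (t : ℕ) (Φ : Fin m → Fin k → Fin n × Bool) (v : Fin n),
        st S (t + 1) Φ v =
          if st S t Φ v = none then
            (if ∃ i : Fin m, i ∉ S ∧ ∃ j : Fin k, (Φ i j).1 = v ∧ ∀ j' : Fin k, j' ≠ j →
                st S t Φ (Φ i j').1 ≠ none ∧ st S t Φ (Φ i j').1 ≠ some (Φ i j').2
              then some (dm S t Φ v)
              else if (v : ℕ) * R / n = t then some true else none)
          else st S t Φ v) ∧
      (∀ (S : Finset (Fin m)) (t : ℕ) (Φ : Fin m → Fin k → Fin n × Bool) (v : Fin n) (i : Fin m)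
        (j : Fin k), i ∉ S → (Φ i j).1 = v → st S t Φ v = none →
        (∀ j' : Fin k, j' ≠ j → st S t Φ (Φ i j').1 ≠ none ∧ st S t Φ (Φ i j').1 ≠ some (Φ i j').2) →
        (∀ i' : Fin m, i' ∉ S → (∃ j₁ : Fin k, (Φ i' j₁).1 = v ∧ ∀ j' : Fin k, j' ≠ j₁ →
          st S t Φ (Φ i' j').1 ≠ none ∧ st S t Φ (Φ i' j').1 ≠ some (Φ i' j').2) → i ≤ i') →
        dm S t Φ v = (Φ i j).2) := by
  -- the value demanded by clause `i₀` on `v` (its sign at the slot holding `v`), read off `σ`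
  let pick : ((Fin m → Fin k → Fin n × Bool) → Fin n → Option Bool) →
      (Fin m → Fin k → Fin n × Bool) → Fin n → Fin m → Bool := fun σ Φ v i₀ =>
    if h' : ∃ j : Fin k, (Φ i₀ j).1 = v ∧ ∀ j' : Fin k, j' ≠ j →
        σ Φ (Φ i₀ j').1 ≠ none ∧ σ Φ (Φ i₀ j').1 ≠ some (Φ i₀ j').2 then (Φ i₀ h'.choose).2 else true
  -- the demanded value: that of the least non-muted unit clause on `v`
  let dmOf : Finset (Fin m) → ((Fin m → Fin k → Fin n × Bool) → Fin n → Option Bool) →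
      (Fin m → Fin k → Fin n × Bool) → Fin n → Bool := fun S σ Φ v =>
    if h : (univ.filter fun i : Fin m => i ∉ S ∧ ∃ j : Fin k, (Φ i j).1 = v ∧ ∀ j' : Fin k, j' ≠ j →
        σ Φ (Φ i j').1 ≠ none ∧ σ Φ (Φ i j').1 ≠ some (Φ i j').2).Nonempty then
      pick σ Φ v ((univ.filter fun i : Fin m => i ∉ S ∧ ∃ j : Fin k, (Φ i j).1 = v ∧ ∀ j' : Fin k, j' ≠ j →
        σ Φ (Φ i j').1 ≠ none ∧ σ Φ (Φ i j').1 ≠ some (Φ i j').2).min' h)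
    else true
  -- one round of the dynamics from the state function `σ` at round `t`
  let step : Finset (Fin m) → ℕ → ((Fin m → Fin k → Fin n × Bool) → Fin n → Option Bool) →
      (Fin m → Fin k → Fin n × Bool) → Fin n → Option Bool := fun S t σ Φ v =>
    if σ Φ v = none then
      (if ∃ i : Fin m, i ∉ S ∧ ∃ j : Fin k, (Φ i j).1 = v ∧ ∀ j' : Fin k, j' ≠ j →
          σ Φ (Φ i j').1 ≠ none ∧ σ Φ (Φ i j').1 ≠ some (Φ i j').2
        then some (dmOf S σ Φ v)
        else if (v : ℕ) * R / n = t then some true else none)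
    else σ Φ v
  let st : Finset (Fin m) → ℕ → (Fin m → Fin k → Fin n × Bool) → Fin n → Option Bool := fun S t =>
    Nat.rec (motive := fun _ => (Fin m → Fin k → Fin n × Bool) → Fin n → Option Bool)
      (fun _ _ => none) (fun t σ => step S t σ) t
  refine ⟨st, fun S t => dmOf S (st S t), fun _ _ _ => rfl, fun S t Φ v => rfl, ?_⟩
  intro S t Φ v i j hiS hij hv hset hleast
  -- any slot of `i` holding `v` is the slot `j` (the other slots are set, `v` is not)
  have hslot : ∀ j₂ : Fin k, (Φ i j₂).1 = v → j₂ = j := by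
    intro j₂ hj₂
    by_contra hne2
    have := (hset j₂ hne2).1
    rw [hj₂] at this
    exact this hv
  -- the filter of non-muted unit clauses on `v` is nonempty and its minimum is `i`
  have hiT : i ∈ (univ.filter fun i : Fin m => i ∉ S ∧ ∃ j : Fin k, (Φ i j).1 = v ∧ ∀ j' : Fin k, j' ≠ j →
      st S t Φ (Φ i j').1 ≠ none ∧ st S t Φ (Φ i j').1 ≠ some (Φ i j').2) := by
    simp only [mem_filter, mem_univ, true_and]
    exact ⟨hiS, j, hij, hset⟩
  have hne : (univ.filter fun i : Fin m => i ∉ S ∧ ∃ j : Fin k, (Φ i j).1 = v ∧ ∀ j' : Fin k, j' ≠ j →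
      st S t Φ (Φ i j').1 ≠ none ∧ st S t Φ (Φ i j').1 ≠ some (Φ i j').2).Nonempty := ⟨i, hiT⟩
  have hmin : (univ.filter fun i : Fin m => i ∉ S ∧ ∃ j : Fin k, (Φ i j).1 = v ∧ ∀ j' : Fin k, j' ≠ j →
      st S t Φ (Φ i j').1 ≠ none ∧ st S t Φ (Φ i j').1 ≠ some (Φ i j').2).min' hne = i := by
    refine le_antisymm (min'_le _ i hiT) ?_
    have hmem := min'_mem _ hne
    simp only [mem_filter, mem_univ, true_and] at hmem
    exact hleast _ hmem.1 hmem.2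
  show dmOf S (st S t) Φ v = (Φ i j).2
  have h1 : dmOf S (st S t) Φ v = pick (st S t) Φ v i := by
    simp only [dmOf]
    rw [dif_pos hne, hmin]
  rw [h1]
  have hex : ∃ j₁ : Fin k, (Φ i j₁).1 = v ∧ ∀ j' : Fin k, j' ≠ j₁ →
      st S t Φ (Φ i j').1 ≠ none ∧ st S t Φ (Φ i j').1 ≠ some (Φ i j').2 := ⟨j, hij, hset⟩
  simp only [pick]
  rw [dif_pos hex, hslot _ hex.choose_spec.1]

end Objects

end Summit.PneNP.PneNP.Theorems
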